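import Summits.CriticalPhenomena.Ising3DConformalLimit.Theses.SubPtolemyInterlacing
import Summits.CriticalPhenomena.Ising3DConformalLimit.Theorems.SubPtolemyInterlacingSubPtolemyFloorFloorOfSusceptibilityFloor
import Summits.CriticalPhenomena.Ising3DConformalLimit.Theorems.SubPtolemyInterlacingSubPtolemyFloorFloorOfDoubling
import Summits.CriticalPhenomena.Ising3DConformalLimit.Theorems.SubPtolemyInterlacingSubPtolemyFloorSusceptibilityFloorOfBoxPairFloor
import Summits.CriticalPhenomena.Ising3DConformalLimit.Theorems.SubPtolemyInterlacingSubPtolemyFloorBoxPairFloorOfBlockTail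
import HarnessLib

/-!
# `SubPtolemyFloor` ⇐ an integrated floor: the three kernel certificates of the line `Sketch`
(crux item stmt-CriticalPhenomena-15703, route decl
`Summit.CriticalPhenomena.Ising3DConformalLimit.Theses.SubPtolemyInterlacing.SubPtolemyFloor`;
checked skeleton `Cruxes/SubPtolemyFloor/Lines/Sketch.lean`, lead seat
`prover-line-stmt-CriticalPhenomena-15703-0`)

The crux is the axial power floor `⟨σ₀σ_{n e₁}⟩_{β_c(3)} ≥ c n^{-a}` with `a < L := log₂(1+√2)` for
the critical nearest-neighbour Ising two-point function `G = criticalTwoPoint 3` on `ℤ³` (an open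
problem: rigorous exponents are `2`, Simon–Lieb, and `3/2` conditionally on η-existence,
Duminil-Copin–Panis 2025). This file composes the landed stubs of the line into three CERTIFICATES
"crux ⇐ residual", each a registered stub of the crux item proved here by name:

* `stub_cruxOfSusceptibilityFloor` — **unconditional transfer**: an integrated floor
  `χ_n := Σ_{x ∈ Λ_n} G(x) ≥ c n^{3-a₀}` with `1 ≤ a₀ < 3L/(2+L) = 1.1661…` gives the crux (stub S1,
  `stub_floorOfSusceptibilityFloor`: infrared subtraction + Messager–Miracle-Solé, exponent
  `a = 2a₀/(3-a₀)`, and the threshold algebra `2a₀/(3-a₀) < L ⇔ a₀(2+L) < 3L`,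
  `subPtolemyFloor_of_transfer`).
* `stub_cruxOfDoublingSusceptibilityFloor` — **lossless transfer under axial doubling**: if moreover
  `G(2n e₁) ≥ κ G(n e₁)` with any `κ > 1/8`, an integrated floor with exponent below the FULL threshold
  `a₀ < L` suffices (stub S2, `stub_floorOfDoubling`; idea card `volume-threshold-split`).
* `stub_cruxOfBlockTail` — **block-spin tail route**: a one-sided tail floor
  `⟨𝟙{n^{3-u} ≤ M_n}⟩⁺_{β_c} ≥ p₀ ∈ (0,1)` for the critical block spin `M_n = Σ_{x∈Λ_n} σ_x` at every
  scale, with `1/2 ≤ u`, `4u/(3-2u) < L` (`u < 0.5830`), gives the crux (stubs S4 → S3 → S1: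
  `stub_boxPairFloorOfBlockTail`, Chebyshev; `stub_susceptibilityFloorOfBoxPairFloor`; S1; idea card
  `lee-yang-tail-transfer`).

What remains OPEN is exactly the antecedent of the first certificate — the registered engine stub
`stub_susceptibilityFloor` of the skeleton (`∃ a₀ ∈ [1, 3L/(2+L))`, `χ_n(β_c) ≥ c n^{3-a₀}`; truth
`a₀ = 2Δ_σ = 1.036`, known `a₀ = 2`). No definitions, no named facts; pure composition.

References: B. Simon, CMP 77 (1980) (IR-subtraction pattern); A. Messager, S. Miracle-Solé, JSP 17
(1977); M. Aizenman, H. Duminil-Copin, Ann. Math. 194 (2021) §5 (MMS folding); H. Duminil-Copin,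
R. Panis, CMP 406 (2025) = arXiv:2404.05700 (nearest prior art, Thm 1.3/1.5).
-/

noncomputable section

namespace Summit.CriticalPhenomena.Ising3DConformalLimit.SubPtolemyFloorSketch

open scoped BigOperators Classical
open Finset Literature.Probability.LatticeModels
open Summit.CriticalPhenomena.Ising3DConformalLimit.Theses.SubPtolemyInterlacing

/-- The Ptolemy exponent `L = log₂(1+√2)` is positive (`1 + √2 > 1`). [folklore] -/
theorem ptolemyExp_pos : 0 < Real.logb 2 (1 + Real.sqrt 2) := by
  have h2 : (0 : ℝ) < Real.sqrt 2 := Real.sqrt_pos.2 two_pos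
  exact Real.logb_pos one_lt_two (by linarith)

/-- **Threshold algebra of the line.** An axial floor with exponent `2a₀/(3-a₀)`, where
`1 ≤ a₀ < 3L/(2+L)` and `L = log₂(1+√2)`, is an axial floor with some exponent `a < L` — i.e. the crux
unfolded: `2a₀/(3-a₀) < L ⇔ a₀ (2+L) < 3L`, and `a₀ < 3` follows from `a₀(2+L) < 3L`. [folklore] -/
theorem subPtolemyFloor_of_transfer {a₀ : ℝ} (h1 : 1 ≤ a₀)
    (hlt : a₀ < 3 * Real.logb 2 (1 + Real.sqrt 2) / (2 + Real.logb 2 (1 + Real.sqrt 2)))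
    (h₁ : 1 ≤ a₀ → a₀ < 3 →
      ∃ c : ℝ, 0 < c ∧ ∀ n : ℕ, 1 ≤ n →
        c * (n : ℝ) ^ (-(2 * a₀ / (3 - a₀))) ≤ criticalTwoPoint 3 ((n : ℤ) • (Pi.single 0 1 : Site 3))) :
    ∃ a c : ℝ, a < Real.logb 2 (1 + Real.sqrt 2) ∧ 0 < c ∧ ∀ n : ℕ, 1 ≤ n →
      c * (n : ℝ) ^ (-a) ≤ criticalTwoPoint 3 ((n : ℤ) • (Pi.single 0 1 : Site 3)) := by
  have hL := ptolemyExp_pos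
  set L := Real.logb 2 (1 + Real.sqrt 2) with hLdef
  have h2L : (0 : ℝ) < 2 + L := by linarith
  have hlt' : a₀ * (2 + L) < 3 * L := by rwa [lt_div_iff₀ h2L] at hlt
  have hlt'' : 2 * a₀ + a₀ * L < 3 * L := by linarith [mul_add a₀ 2 L, mul_comm a₀ (2 : ℝ)]
  have h3 : a₀ < 3 := by
    by_contra h
    have h' : (3 : ℝ) ≤ a₀ := not_lt.1 h
    have : 3 * L ≤ a₀ * L := mul_le_mul_of_nonneg_right h' hL.le
    linarith
  obtain ⟨c, hc, h⟩ := h₁ h1 h3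
  refine ⟨2 * a₀ / (3 - a₀), c, ?_, hc, h⟩
  rw [div_lt_iff₀ (sub_pos.2 h3)]
  linarith [mul_sub L 3 a₀, mul_comm a₀ L]

/-- **Certificate 1 (unconditional transfer): the crux from an integrated floor below `3L/(2+L)`.**
If `χ_n(β_c) = Σ_{x∈Λ_n} ⟨σ₀σ_x⟩_{β_c(3)} ≥ c n^{3-a₀}` for all `n ≥ 1` with `1 ≤ a₀ < 3L/(2+L)`
(`= 1.1661…`, `L = log₂(1+√2)`), then `SubPtolemyFloor` holds, with axial exponent `2a₀/(3-a₀) < L`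
(stub S1 `stub_floorOfSusceptibilityFloor` + `subPtolemyFloor_of_transfer`). The antecedent is the
line's one open stub `stub_susceptibilityFloor`. [folklore] -/
theorem stub_cruxOfSusceptibilityFloor :
    (∃ a₀ : ℝ, 1 ≤ a₀ ∧
      a₀ < 3 * Real.logb 2 (1 + Real.sqrt 2) / (2 + Real.logb 2 (1 + Real.sqrt 2)) ∧
      ∃ c : ℝ, 0 < c ∧ ∀ n : ℕ, 1 ≤ n →
        c * (n : ℝ) ^ (3 - a₀) ≤ ∑ x ∈ box 3 n, criticalTwoPoint 3 x) →
    SubPtolemyFloor := by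
  rintro ⟨a₀, h1, hlt, hS⟩
  exact subPtolemyFloor_of_transfer h1 hlt fun h1' h3 => stub_floorOfSusceptibilityFloor a₀ h1' h3 hS

/-- **Certificate 2 (lossless transfer under doubling): the crux from axial doubling with a constant
above `1/8` and an integrated floor below the full Ptolemy threshold.** If
`⟨σ₀σ_{2n e₁}⟩_{β_c} ≥ κ ⟨σ₀σ_{n e₁}⟩_{β_c}` for all `n ≥ 1` with `κ > 1/8`, and `χ_n(β_c) ≥ c n^{3-a₀}`
with `a₀ < L = log₂(1+√2)`, then `SubPtolemyFloor` holds with exponent `a₀` itself (stub S2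
`stub_floorOfDoubling`: the box sum is carried by its top scale, `χ_n ≤ C_κ n³ ⟨σ₀σ_{ne₁}⟩`).
[folklore] -/
theorem stub_cruxOfDoublingSusceptibilityFloor :
    (∃ κ a₀ : ℝ, 1 / 8 < κ ∧ a₀ < Real.logb 2 (1 + Real.sqrt 2) ∧
      (∀ n : ℕ, 1 ≤ n →
        κ * criticalTwoPoint 3 ((n : ℤ) • (Pi.single 0 1 : Site 3)) ≤
          criticalTwoPoint 3 (((2 * n : ℕ) : ℤ) • (Pi.single 0 1 : Site 3))) ∧
      ∃ c : ℝ, 0 < c ∧ ∀ n : ℕ, 1 ≤ n →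
        c * (n : ℝ) ^ (3 - a₀) ≤ ∑ x ∈ box 3 n, criticalTwoPoint 3 x) →
    SubPtolemyFloor := by
  rintro ⟨κ, a₀, hκ, ha, hd, hs⟩
  obtain ⟨c, hc, h⟩ := stub_floorOfDoubling κ a₀ hκ hd hs
  exact ⟨a₀, c, ha, hc, h⟩

/-- **Certificate 3 (block-spin tail route): the crux from a one-sided tail floor for the critical
block spin.** If for some `u` with `1/2 ≤ u`, `2u < 3`, `4u/(3-2u) < L = log₂(1+√2)` (i.e.
`u < 0.5830…`) and some `p₀ ∈ (0,1)` the critical plus state gives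
`⟨𝟙{n^{3-u} ≤ M_n}⟩⁺_{β_c(3)} ≥ p₀` at every scale `n ≥ 1` (`M_n = Σ_{x∈Λ_n} σ_x`), then
`SubPtolemyFloor` holds: Chebyshev gives `Σ_{a,b∈Λ_n} G(b-a) = ⟨M_n²⟩ ≥ p₀ n^{6-2u}` (stub S4),
`⟨M_n²⟩ ≤ |Λ_n| χ_{2n}` gives `χ_n ≥ c n^{3-2u}` (stub S3), and Certificate 1's transfer (stub S1)
gives the axial exponent `4u/(3-2u)`. [folklore] -/
theorem stub_cruxOfBlockTail :
    (∃ u p₀ : ℝ, 1 / 2 ≤ u ∧ 2 * u < 3 ∧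
      4 * u / (3 - 2 * u) < Real.logb 2 (1 + Real.sqrt 2) ∧ 0 < p₀ ∧ p₀ < 1 ∧
      ∀ n : ℕ, 1 ≤ n →
        p₀ ≤ plusExpect 3 (criticalBeta 3) 0
          (fun σ => if (n : ℝ) ^ (3 - u) ≤ ∑ x ∈ box 3 n, spinAt x σ then 1 else 0)) →
    SubPtolemyFloor := by
  rintro ⟨u, p₀, hu, hu3, hu', hp, hp1, hT⟩
  have hB := stub_boxPairFloorOfBlockTail u p₀ hp hp1 hT
  have hS := stub_susceptibilityFloorOfBoxPairFloor (6 - 2 * u) (by linarith) hB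
  obtain ⟨c, hc, h⟩ :=
    stub_floorOfSusceptibilityFloor (6 - (6 - 2 * u)) (by linarith) (by linarith) hS
  refine ⟨2 * (6 - (6 - 2 * u)) / (3 - (6 - (6 - 2 * u))), c, ?_, hc, h⟩
  have e1 : (2 * (6 - (6 - 2 * u)) : ℝ) = 4 * u := by ring
  have e2 : (3 - (6 - (6 - 2 * u)) : ℝ) = 3 - 2 * u := by ring
  rw [e1, e2]
  exact hu'

end Summit.CriticalPhenomena.Ising3DConformalLimit.SubPtolemyFloorSketch

end
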